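/-
Copyright (c) 2026 the pub-hodgecm-mathlib formalisation cell (harness21).  Prover seat hodgecm-mathlib-B-p14 (g42): the CAPSTONE of the wild quadratic layer — `[K^× : N(K(√u)^×)] = 2`
for EVERY non-square `u` of a complete dyadic field with finite residue field, from Hensel's lemma alone (LH4-plan WORDs #25∕#30∕#35; census F0P3a-p06 (g17) §3); 2026-09-02.
-/
import Literature.NumberTheory.LocalFields.WildQuadraticNormsUnitIndexTwo   -- ★ (C3); brings ★ UnitConductor (C1)(C2), ★ IndexTwo (63:11), ★ Descent, ★ Exactness, ★ NearOne
import HarnessLib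

/-!
# Wild quadratic norms — THE LOCAL NORM INDEX THEOREM at a dyadic place: for every non-square `u ≠ 0`, `K^× = N(K(√u)^×) ⊔ x₀·N(K(√u)^×)` for some `x₀`
# (the ★-ladder CLASSIFICATION of unit square classes + the three ★ cases: odd order, unit of odd defect, unit of defect `4𝒪`)

Topic `NumberTheory/LocalFields`; namespace `Literature.NumberTheory.LocalFields`.  THEOREMS ONLY (no definition, no instance, no notation, no named fact, no `sorry`);
CM-free; kernel lane `--supports stmt-HodgeConjecture-24833`.  Cell `pub/hodgecm-mathlib` (D-0151), crux H413 = `stmt-HodgeConjecture-24833`; half A line LH4, DYADIC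
pay-down leaf `Cruxes/H413/Lines/F0_P3c_DyadicPaydown.lean`, organs (D-UNR)∕(D-RAM) (PRINT this week; census F0P3a-p06 (g17) OUTCOME B: M4∕M6 need the norm groups of the
wild quadratic tori `T = Res¹ K(√u)^×`; `#(K^×∕N) = 2` is the Tamagawa∕Kottwitz-sign input at the place).  Seventh file of the wild quadratic entry layer: ★
`WildQuadraticNormsNearOne` ((W1)–(W4)) · ★ `…Exactness` ((X1)–(X6)) · ★ `…Descent` · ★ `…IndexTwo` (odd order) · ★ `…UnitConductor` ((C1)(C2)) · ★ `…UnitIndexTwo`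
((C3)).  Same define-free currency (`Valued.v : K → ℤᵐ⁰`; «`x ∈ N_u`» := `∃ a b, a·a − u·(b·b) = x`; «non-square» := `∀ r, r·r ≠ u`; uniformiser binder
`hϖ : v ϖ = exp(−1)`).  HONEST LABEL: HC_CM is proved only modulo the 7 printed citations (2 remaining named inputs: hLiu418 = stmt-HodgeConjecture-24832, h413 =
stmt-HodgeConjecture-24833) until rung 0 closes; count-neutral, Mathlib-footed, bankable.

THE MATHEMATICS:
* (C4) `exists_unit_mul_sq_depth_dichotomy` — THE ★-LADDER CLASSIFICATION (O'Meara 63:2: «`𝔡(ε)` is one of `0 ⊂ 4𝒪 ⊂ 4𝔭⁻¹ ⊂ … ⊂ 𝔭³ ⊂ 𝔭`», odd exponents): for a unit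
  `u` there is a unit `t` with EITHER `v(ut² − 1) ≤ v 4` (depth `≥ 2e`) OR `v 4 < v(ut² − 1) < 1` of ODD depth (not a square value) — descent on the depth: normalise
  `u c⁻² ≡ 1` (`c̄² = ū`), at an even depth `< 2e` apply the ladder ★ (W4), stop at an odd depth or at `≥ 2e`.
* `exists_nonnorm_dichotomy_of_forall_mul_self_ne` — **THE LOCAL NORM INDEX THEOREM**: `K` complete, `[Finite 𝓀[K]]`, `2 ≠ 0`, `v 2 < 1`, uniformiser `ϖ`; for every
  `u ≠ 0` which is NOT a square there is `x₀` with `x₀ ∉ N(K(√u)^×)` and `∀ y ≠ 0, y ∈ N ∨ y·x₀ ∈ N` — i.e. `[K^× : N(K(√u)^×)] = 2`.  Cases (norm groups depend only on the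
  square class, ★ `exists_sq_sub_mul_sq_iff_mul_sq`): `v u` odd ⇒ ★ 63:11 (`x₀ = Δ`); `v u` even ⇒ `u(ϖ^r)²` is a unit, classified by (C4): odd defect ⇒ ★ (C3)
  (`x₀ = 1 + 4η∕w`); depth `≥ 2e`, `ut² = 1 + 4η′`: `η̄′ ∈ ℘` would make `u` a square (★ X5 ⇐), so `η̄′ ∉ ℘`, `ut²` is in the `Δ`-class and ★
  `exists_sq_sub_delta_mul_sq_iff_valued_eq_sq` gives `N = {even order}`, `x₀ = ϖ`.
* `exists_nonnorm_dichotomy_adicCompletion` — the same in `F_v` for a number field `F` at a dyadic place, hypothesis-free but for the uniformiser binder and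
  «`u` non-square».
This is what local class field theory (`K^×∕N_{L∕K}L^× ≅ Gal(L∕K)`, [NeukirchANT1999 V (1.3)]) predicts for `[L : K] = 2`; here it is PROVED for the wildly ramified
quadratic extensions of dyadic completions with no cohomology and no class field theory — Hensel's lemma, the quadratic defect, and the symmetry of the norm relation.

## References
* [Omeara1963] O. T. O'Meara, *Introduction to Quadratic Forms*, Grundlehren 117 (1963), §63A 63:2–63:5 (the quadratic defect of a unit; held copy p. 163–165), §63B 63:9–63:11a.
* [Serre1979] J.-P. Serre, *Local Fields*, GTM 67 (1979), Ch. XIV §§3–4 (local symbols, the dyadic computation); Ch. XV §2 (norm groups).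
* [NeukirchANT1999] J. Neukirch, *Algebraic Number Theory* (1999), Ch. V (1.3) (the local reciprocity law ∕ norm index), Ch. V §3.
-/

set_option autoImplicit false

noncomputable section

open scoped Valued WithZero
open WithZero NumberField IsDedekindDomain

namespace Literature.NumberTheory.LocalFields

section Classification
variable {K : Type*} [Field K] [Valued K ℤᵐ⁰]

/-- **(C4) THE ★-LADDER CLASSIFICATION OF UNIT SQUARE CLASSES** (O'Meara 63:2: the quadratic defect of a dyadic unit is `0`, `4𝒪`, or `𝔭^s` with `s` ODD `< 2e`): `2 ≠ 0`,
`v 2 < 1`, every residue a square, a uniformiser `ϖ`.  For a unit `u` there is a unit `t` with `v(u·t·t − 1) ≤ v 4` (depth `≥ 2e`), or `v 4 < v(u·t·t − 1) < 1` with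
`v(u·t·t − 1)` NOT a square value (odd depth).  Descent on the depth `k < 2e`: at an even depth the ladder ★ `exists_valued_mul_sq_sub_one_lt` (W4) deepens; an odd depth or
depth `≥ 2e` stops.  No completeness. [cite: Omeara1963, §63A 63:2, 63:5] [cite: Serre1979, Ch. XIV §4] -/
theorem exists_unit_mul_sq_depth_dichotomy (h2 : (2 : K) ≠ 0) (h2v : Valued.v (2 : K) < 1)
    (hres : ∀ c : K, Valued.v c ≤ 1 → ∃ y : K, Valued.v y ≤ 1 ∧ Valued.v (y * y - c) < 1)
    {ϖ : K} (hϖ : Valued.v ϖ = exp (-1 : ℤ)) {u : K} (hu : Valued.v u = 1) :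
    ∃ t : K, Valued.v t = 1 ∧ (Valued.v (u * (t * t) - 1) ≤ Valued.v (4 : K) ∨
      (Valued.v (4 : K) < Valued.v (u * (t * t) - 1) ∧ Valued.v (u * (t * t) - 1) < 1 ∧
        ∀ y : K, Valued.v (u * (t * t) - 1) ≠ Valued.v y * Valued.v y)) := by
  obtain ⟨e, he1, he⟩ := exists_valued_two_eq_exp_nat h2 h2v
  have hv4 : Valued.v (4 : K) = exp (-(2 * (e : ℤ))) := by
    rw [show (4 : K) = 2 * 2 by norm_num, map_mul, he, ← exp_add, exp_inj]
    ring
  have hu0 : u ≠ 0 := (Valuation.ne_zero_iff _).1 (by rw [hu]; exact one_ne_zero)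
  -- the descent: from a unit `t` with `v(ut² − 1) ≤ exp(−(2e − d))`, `< 1`, reach the dichotomy
  have hdesc : ∀ d : ℕ, ∀ t : K, Valued.v t = 1 → Valued.v (u * (t * t) - 1) < 1 → Valued.v (u * (t * t) - 1) ≤ exp (-(2 * (e : ℤ) - (d : ℤ))) →
      ∃ t : K, Valued.v t = 1 ∧ (Valued.v (u * (t * t) - 1) ≤ Valued.v (4 : K) ∨
        (Valued.v (4 : K) < Valued.v (u * (t * t) - 1) ∧ Valued.v (u * (t * t) - 1) < 1 ∧
          ∀ y : K, Valued.v (u * (t * t) - 1) ≠ Valued.v y * Valued.v y)) := by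
    intro d
    induction d with
    | zero =>
      intro t ht hz1 hzd
      rw [Nat.cast_zero, sub_zero, ← hv4] at hzd
      exact ⟨t, ht, Or.inl hzd⟩
    | succ d ih =>
      intro t ht hz1 hzd
      by_cases hdeep : Valued.v (u * (t * t) - 1) ≤ exp (-(2 * (e : ℤ) - (d : ℤ)))
      · exact ih t ht hz1 hdeep
      · rw [not_le] at hdeep
        have hk1 : -(2 * (e : ℤ) - ((d + 1 : ℕ) : ℤ)) = -(2 * (e : ℤ) - d - 1) := by push_cast; ring
        rw [hk1] at hzd
        have hk2 : -(2 * (e : ℤ) - (d : ℤ)) = -((2 * (e : ℤ) - d - 1) + 1) := by ring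
        rw [hk2] at hdeep
        have heq : Valued.v (u * (t * t) - 1) = exp (-(2 * (e : ℤ) - d - 1)) := eq_exp_of_lt_of_le hdeep hzd
        have hkpos : 0 < 2 * (e : ℤ) - d - 1 := by
          have h := hz1
          rw [heq, ← exp_zero, exp_lt_exp] at h
          omega
        rcases Int.even_or_odd (2 * (e : ℤ) - d - 1) with ⟨r, hr⟩ | ⟨j, hj⟩
        · -- even depth `< 2e`: the ladder
          have hy : Valued.v (u * (t * t) - 1) = Valued.v (ϖ ^ r) * Valued.v (ϖ ^ r) := by
            rw [valued_uniformizer_zpow hϖ, heq, ← exp_add, exp_inj]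
            omega
          have h2y : Valued.v (2 : K) < Valued.v (ϖ ^ r) := by
            rw [he, valued_uniformizer_zpow hϖ, exp_lt_exp]
            omega
          obtain ⟨t', ht', hlt⟩ := exists_valued_mul_sq_sub_one_lt hres hz1 hy h2y
          refine ih (t * t') (by rw [map_mul, ht, ht', mul_one]) ?_ ?_
          · rw [show u * (t * t' * (t * t')) - 1 = u * (t * t) * (t' * t') - 1 by ring]
            exact hlt.trans hz1
          · rw [show u * (t * t' * (t * t')) - 1 = u * (t * t) * (t' * t') - 1 by ring, hk2]
            exact le_exp_of_lt_exp (by rw [← heq]; exact hlt)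
        · -- odd depth: stop here
          refine ⟨t, ht, Or.inr ⟨?_, hz1, ?_⟩⟩
          · rw [hv4, heq, exp_lt_exp]
            omega
          · exact valued_ne_mul_self_of_eq_exp_odd (u := u * (t * t) - 1) (n := -j - 1) (by rw [heq, hj]; congr 1; ring)
  -- start: `c̄² = ū`, `t₀ = c⁻¹`
  obtain ⟨c, hc1, hc⟩ := hres u hu.le
  have hcu : Valued.v c = 1 := by
    have hsq : Valued.v (c * c) = 1 := by
      have h := Valuation.map_add_eq_of_lt_left Valued.v (x := u) (y := c * c - u) (by rw [hu]; exact hc)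
      rwa [add_sub_cancel, hu] at h
    refine hc1.lt_or_eq.resolve_left fun hlt => (lt_irrefl (1 : ℤᵐ⁰)) ?_
    calc (1 : ℤᵐ⁰) = Valued.v c * Valued.v c := by rw [← map_mul, hsq]
      _ < 1 := mul_lt_one' hlt hlt
  have hc0 : c ≠ 0 := (Valuation.ne_zero_iff _).1 (by rw [hcu]; exact one_ne_zero)
  have hz1 : Valued.v (u * (c⁻¹ * c⁻¹) - 1) < 1 := by
    rw [show u * (c⁻¹ * c⁻¹) - 1 = -((c * c - u) * (c⁻¹ * c⁻¹)) by field_simp; ring, Valuation.map_neg, map_mul, map_mul, map_inv₀, hcu,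
      inv_one, mul_one, mul_one]
    exact hc
  refine hdesc (2 * e - 1) c⁻¹ (by rw [map_inv₀, hcu, inv_one]) hz1 ?_
  have hcast : -(2 * (e : ℤ) - ((2 * e - 1 : ℕ) : ℤ)) = -((0 : ℤ) + 1) := by push_cast [show 1 ≤ 2 * e by omega]; ring
  rw [hcast]
  exact le_exp_of_lt_exp (by rw [neg_zero, exp_zero]; exact hz1)

end Classification

section NormIndex
variable {K : Type*} [Field K] [Valued K ℤᵐ⁰]

/-- **THE LOCAL NORM INDEX THEOREM AT A DYADIC PLACE** (define-free `[K^× : N(K(√u)^×)] = 2`): `K` complete with finite residue field, `2 ≠ 0`, `v 2 < 1`, a uniformiser `ϖ`.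
For every `u ≠ 0` that is NOT a square there is `x₀` with `x₀ ∉ N(K(√u)^×)` and `∀ y ≠ 0, y ∈ N(K(√u)^×) ∨ y·x₀ ∈ N(K(√u)^×)`.  Cases on the square class of `u`
(★ `exists_sq_sub_mul_sq_iff_mul_sq`): odd order ⇒ ★ 63:11 `exists_delta_norm_dichotomy_of_finite_residueField` (`x₀ = Δ`); even order ⇒ unit, then (C4): odd defect ⇒ ★ (C3)
`exists_norm_dichotomy_one_add_of_finite_residueField` (`x₀ = 1 + 4η∕w`); depth `≥ 2e`, `ut² = 1 + 4η′` with `η̄′ ∉ ℘` (else `u` is a square, ★ (X5 ⇐)) ⇒ the `Δ`-class, ★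
`exists_sq_sub_delta_mul_sq_iff_valued_eq_sq` (`x₀ = ϖ`).  [cite: NeukirchANT1999, Ch. V (1.3)] [cite: Omeara1963, §63B 63:9–63:11a] [cite: Serre1979, Ch. XIV §4; Ch. XV §2] -/
theorem exists_nonnorm_dichotomy_of_forall_mul_self_ne [IsAdicComplete 𝓂[K] 𝒪[K]] [Finite 𝓀[K]] (h2 : (2 : K) ≠ 0) (h2v : Valued.v (2 : K) < 1)
    {ϖ : K} (hϖ : Valued.v ϖ = exp (-1 : ℤ)) {u : K} (hu0 : u ≠ 0) (hns : ∀ r : K, r * r ≠ u) :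
    ∃ x₀ : K, (¬ ∃ a b : K, a * a - u * (b * b) = x₀) ∧
      ∀ y : K, y ≠ 0 → (∃ a b : K, a * a - u * (b * b) = y) ∨ (∃ a b : K, a * a - u * (b * b) = y * x₀) := by
  have hres := exists_valued_mul_self_sub_lt_one_of_finite_residueField (K := K) h2v
  have hϖ0 : ϖ ≠ 0 := (Valuation.ne_zero_iff _).1 (by rw [hϖ]; exact exp_ne_zero)
  have hvu0 : Valued.v u ≠ 0 := (Valuation.ne_zero_iff _).2 hu0
  -- norm groups depend only on the square class: transfer along `u ↦ u·s²`
  have htransfer : ∀ s : K, s ≠ 0 → (∃ x₀ : K, (¬ ∃ a b : K, a * a - u * (s * s) * (b * b) = x₀) ∧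
      ∀ y : K, y ≠ 0 → (∃ a b : K, a * a - u * (s * s) * (b * b) = y) ∨ (∃ a b : K, a * a - u * (s * s) * (b * b) = y * x₀)) →
      ∃ x₀ : K, (¬ ∃ a b : K, a * a - u * (b * b) = x₀) ∧
        ∀ y : K, y ≠ 0 → (∃ a b : K, a * a - u * (b * b) = y) ∨ (∃ a b : K, a * a - u * (b * b) = y * x₀) := by
    rintro s hs0 ⟨x₀, hx₀, hall⟩
    refine ⟨x₀, fun h => hx₀ ((exists_sq_sub_mul_sq_iff_mul_sq u hs0 x₀).1 h), fun y hy0 => ?_⟩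
    rcases hall y hy0 with h | h
    · exact Or.inl ((exists_sq_sub_mul_sq_iff_mul_sq u hs0 y).2 h)
    · exact Or.inr ((exists_sq_sub_mul_sq_iff_mul_sq u hs0 _).2 h)
  rcases Int.even_or_odd (log (Valued.v u)) with ⟨r, hr⟩ | ⟨j, hj⟩
  · -- even order: `u·(ϖ^r)²` is a unit
    have hs0 : ϖ ^ r ≠ 0 := zpow_ne_zero _ hϖ0
    have hunit : Valued.v (u * (ϖ ^ r * ϖ ^ r)) = 1 := by
      rw [map_mul, map_mul, valued_uniformizer_zpow hϖ, ← exp_log hvu0, hr, ← exp_add, ← exp_add, ← exp_zero, exp_inj]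
      ring
    refine htransfer (ϖ ^ r) hs0 ?_
    set u₁ : K := u * (ϖ ^ r * ϖ ^ r) with hu₁
    clear_value u₁
    obtain ⟨t, ht, hdich⟩ := exists_unit_mul_sq_depth_dichotomy h2 h2v hres hϖ hunit
    have ht0 : t ≠ 0 := (Valuation.ne_zero_iff _).1 (by rw [ht]; exact one_ne_zero)
    -- pass to `z := u₁ t²`, same norm group
    suffices hz : ∃ x₀ : K, (¬ ∃ a b : K, a * a - u₁ * (t * t) * (b * b) = x₀) ∧
        ∀ y : K, y ≠ 0 → (∃ a b : K, a * a - u₁ * (t * t) * (b * b) = y) ∨ (∃ a b : K, a * a - u₁ * (t * t) * (b * b) = y * x₀) by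
      obtain ⟨x₀, hx₀, hall⟩ := hz
      refine ⟨x₀, fun h => hx₀ ((exists_sq_sub_mul_sq_iff_mul_sq u₁ ht0 x₀).1 h), fun y hy0 => ?_⟩
      rcases hall y hy0 with h | h
      · exact Or.inl ((exists_sq_sub_mul_sq_iff_mul_sq u₁ ht0 y).2 h)
      · exact Or.inr ((exists_sq_sub_mul_sq_iff_mul_sq u₁ ht0 _).2 h)
    rcases hdich with hdeep | ⟨h4z, hz1, hzodd⟩
    · -- depth `≥ 2e`: `z = 1 + 4η′`; `η̄′ ∈ ℘` impossible (square), so the `Δ`-class: `N = {even order}`, `x₀ = ϖ`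
      have h40 : (4 : K) ≠ 0 := by
        rw [show (4 : K) = 2 * 2 by norm_num]
        exact mul_ne_zero h2 h2
      have hv40 : Valued.v (4 : K) ≠ 0 := (Valuation.ne_zero_iff _).2 h40
      set η' : K := (u₁ * (t * t) - 1) * (4 : K)⁻¹ with hη'
      clear_value η'
      have hzη : u₁ * (t * t) = 1 + 4 * η' := by
        rw [hη']
        field_simp
        ring
      have hη'1 : Valued.v η' ≤ 1 := by
        rw [hη', map_mul, map_inv₀]
        calc Valued.v (u₁ * (t * t) - 1) * (Valued.v (4 : K))⁻¹ ≤ Valued.v (4 : K) * (Valued.v (4 : K))⁻¹ := mul_le_mul_left hdeep _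
          _ = 1 := mul_inv_cancel₀ hv40
      have hη' : ∀ ρ : K, Valued.v ρ ≤ 1 → 1 ≤ Valued.v (ρ * ρ + ρ - η') := by
        intro ρ hρ1
        by_contra hlt
        rw [not_le] at hlt
        obtain ⟨r', hr'⟩ := exists_mul_self_eq_one_add_four_mul h2v hρ1 hlt
        -- `u₁ t² = r'²` ⇒ `u` is a square
        rw [← hzη] at hr'
        refine hns (r' * (ϖ ^ r * t)⁻¹) ?_
        rw [hu₁] at hr'
        have hne : ϖ ^ r * t ≠ 0 := mul_ne_zero hs0 ht0
        field_simp
        linear_combination hr'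
      rw [hzη]
      refine ⟨ϖ, fun h => ?_, fun y hy0 => ?_⟩
      · -- `ϖ ∉ N(K(√Δ′))`: odd order
        obtain ⟨y, hy⟩ := (exists_sq_sub_delta_mul_sq_iff_valued_eq_sq h2 h2v hres hη'1 hη' hϖ0).1 h
        exact valued_ne_mul_self_of_eq_exp_odd (u := ϖ) (n := -1) (hϖ.trans (congrArg exp (by norm_num))) y hy
      · have hvy0 : Valued.v y ≠ 0 := (Valuation.ne_zero_iff _).2 hy0
        rcases Int.even_or_odd (log (Valued.v y)) with ⟨r₂, hr₂⟩ | ⟨j₂, hj₂⟩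
        · refine Or.inl ((exists_sq_sub_delta_mul_sq_iff_valued_eq_sq h2 h2v hres hη'1 hη' hy0).2 ⟨ϖ ^ (-r₂), ?_⟩)
          rw [valued_uniformizer_zpow hϖ, ← exp_add, ← exp_log hvy0, hr₂]
          all_goals (congr 1; ring)
        · refine Or.inr ((exists_sq_sub_delta_mul_sq_iff_valued_eq_sq h2 h2v hres hη'1 hη' (mul_ne_zero hy0 hϖ0)).2 ⟨ϖ ^ (-j₂), ?_⟩)
          rw [map_mul, hϖ, valued_uniformizer_zpow hϖ, ← exp_add, ← exp_log hvy0, hj₂, ← exp_add]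
          all_goals (congr 1; ring)
    · -- odd defect: ★ (C3) with `x₀ = 1 + 4η∕w`, `w = z − 1`
      obtain ⟨η, -, hx₀, hall⟩ := exists_norm_dichotomy_one_add_of_finite_residueField h2 h2v hϖ hz1 h4z hzodd
      have hzw : u₁ * (t * t) = 1 + (u₁ * (t * t) - 1) := by ring
      refine ⟨1 + 4 * η * (u₁ * (t * t) - 1)⁻¹, fun h => hx₀ ?_, fun y hy0 => ?_⟩
      · rwa [← hzw]
      · have h := hall y hy0
        rwa [← hzw] at h
  · -- odd order: ★ 63:11
    have huodd : ∀ y : K, Valued.v u ≠ Valued.v y * Valued.v y := by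
      refine valued_ne_mul_self_of_eq_exp_odd (n := j) ?_
      rw [← exp_log hvu0, hj]
    obtain ⟨η₀, -, hΔ, hall⟩ := exists_delta_norm_dichotomy_of_finite_residueField h2 h2v hϖ huodd
    exact ⟨1 + 4 * η₀, hΔ, hall⟩

end NormIndex

/-! ## The completion `F_v` of a number field at a dyadic place -/
section AdicCompletion
variable (F : Type*) [Field F] [NumberField F] (v : HeightOneSpectrum (𝓞 F))

/-- **THE LOCAL NORM INDEX THEOREM IN `F_v`** (a number field `F`, a dyadic place `v`: `v(2) < 1`; uniformiser binder): for every non-square `u ≠ 0` of `F_v` there is `x₀ ∈ F_v` with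
`x₀ ∉ N(F_v(√u)^×)` and `∀ y ≠ 0, y ∈ N ∨ y·x₀ ∈ N` — `[F_v^× : N(F_v(√u)^×)] = 2` for every quadratic extension of the dyadic completion, from Hensel's lemma alone.
[cite: NeukirchANT1999, Ch. V (1.3)] [cite: Omeara1963, §63B 63:9–63:11a] [cite: Serre1979, Ch. XV §2] -/
theorem exists_nonnorm_dichotomy_adicCompletion (h2v : Valued.v (2 : v.adicCompletion F) < 1) {ϖ : v.adicCompletion F}
    (hϖ : Valued.v ϖ = exp (-1 : ℤ)) {u : v.adicCompletion F} (hu0 : u ≠ 0) (hns : ∀ r : v.adicCompletion F, r * r ≠ u) :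
    ∃ x₀ : v.adicCompletion F, (¬ ∃ a b : v.adicCompletion F, a * a - u * (b * b) = x₀) ∧
      ∀ y : v.adicCompletion F, y ≠ 0 →
        (∃ a b : v.adicCompletion F, a * a - u * (b * b) = y) ∨ (∃ a b : v.adicCompletion F, a * a - u * (b * b) = y * x₀) := by
  haveI := Literature.NumberTheory.Automorphic.isAdicComplete_valuedMaximalIdeal_valuedInteger_adicCompletion F v
  haveI : Finite 𝓀[v.adicCompletion F] := Literature.NumberTheory.Automorphic.finite_residueField_adicCompletion F v
  have h2 : (2 : v.adicCompletion F) ≠ 0 := by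
    rw [show (2 : v.adicCompletion F) = algebraMap F (v.adicCompletion F) 2 by rw [map_ofNat]]
    exact (_root_.map_ne_zero (algebraMap F (v.adicCompletion F))).2 two_ne_zero
  exact exists_nonnorm_dichotomy_of_forall_mul_self_ne h2 h2v hϖ hu0 hns

end AdicCompletion

end Literature.NumberTheory.LocalFields

end
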